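import Literature.MathematicalPhysics.QuantumLattice.LatticeGaugeDLR
import Mathlib.MeasureTheory.Integral.DominatedConvergence
import Mathlib.Analysis.SpecialFunctions.Trigonometric.Bounds
import Mathlib.MeasureTheory.Function.L2Space
import HarnessLib

/-!
# Stub `stub_cosMoment` of line `Sketch` (crux `stmt-QuantumFields-8760`)

Route `EquipartitionCriticality` of `YangMills`, crux item `stmt-QuantumFields-8760`
(`Summit.QuantumFields.YangMills.Theses.EquipartitionCriticality.EquipartitionPinsProbe`), line
`Sketch`, STUB F6 ("cos moment") of the lead's skeleton.

What is proved: for a probability measure `τ` on `ℝ^D`-valued `2`-cochains of `ℤ⁴` with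
square-integrable coordinates, the second moment of a finite pairing
`X := ⟨Y, h⟩_S = ∑_{p ∈ S} ∑_a h p a * Y p a` is read off the characteristic functional:
`(1 - E[cos(s X)]) / s² → E[X²] / 2` as `s → 0`, `s ≠ 0`.

Proof: `X ∈ L²(τ)` (finite sum of `L²` coordinates), so `X²` is integrable. Since `τ` is a
probability measure, `(1 - ∫ cos(s X)) / s² = ∫ (1 - cos(s X)) / s²`. Dominated convergence
along the countably generated filter `𝓝[≠] 0`
(`MeasureTheory.tendsto_integral_filter_of_dominated_convergence`) with the bound
`|(1 - cos(s x)) / s²| ≤ x² / 2` (`Real.one_sub_sq_div_two_le_cos`, `Real.cos_le_one`) and the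
pointwise limit `(1 - cos(s x)) / s² → x² / 2`, obtained by squeezing with
`Real.cos_bound : |u| ≤ 1 → |cos u - (1 - u²/2)| ≤ |u|⁴ (5/96)`, i.e.
`|(1 - cos(s x)) / s² - x²/2| ≤ (5/96) x⁴ s²` once `|s x| ≤ 1`.
-/

noncomputable section

open MeasureTheory Filter
open scoped Topology Real

open Literature.MathematicalPhysics.QuantumLattice

namespace Summit.QuantumFields.YangMills.Theorems.EquipartitionPinsProbe

namespace CosMoment

/-- Uniform domination: `‖(1 - cos(s x)) / s²‖ ≤ x² / 2` for all real `s`, `x`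
(from `1 - u²/2 ≤ cos u ≤ 1`; the case `s = 0` reads `0 ≤ x²/2`). -/
theorem norm_one_sub_cos_div_sq_le (s x : ℝ) :
    ‖(1 - Real.cos (s * x)) / s ^ 2‖ ≤ x ^ 2 / 2 := by
  rw [Real.norm_eq_abs, abs_div, abs_of_nonneg (sub_nonneg.2 (Real.cos_le_one _)),
    abs_of_nonneg (sq_nonneg s)]
  rcases eq_or_ne s 0 with rfl | hs
  · have : (0 : ℝ) ≤ x ^ 2 / 2 := by positivity
    simpa using this
  · rw [div_le_iff₀ (by positivity : (0 : ℝ) < s ^ 2)]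
    have h1 := Real.one_sub_sq_div_two_le_cos (x := s * x)
    have h2 : (s * x) ^ 2 / 2 = x ^ 2 / 2 * s ^ 2 := by ring
    linarith

/-- Pointwise second-order expansion of the cosine at `0`:
`(1 - cos(s x)) / s² → x² / 2` as `s → 0`, `s ≠ 0` (squeeze with `Real.cos_bound`). -/
theorem tendsto_one_sub_cos_div_sq (x : ℝ) :
    Tendsto (fun s : ℝ => (1 - Real.cos (s * x)) / s ^ 2) (𝓝[≠] 0) (𝓝 (x ^ 2 / 2)) := by
  have h0 : Tendsto (fun s : ℝ => |s * x|) (𝓝[≠] (0 : ℝ)) (𝓝 0) := by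
    have : Tendsto (fun s : ℝ => |s * x|) (𝓝 (0 : ℝ)) (𝓝 (|0 * x|)) :=
      ((continuous_id.mul continuous_const).abs).tendsto 0
    rw [zero_mul, abs_zero] at this
    exact this.mono_left nhdsWithin_le_nhds
  have hev : ∀ᶠ s : ℝ in 𝓝[≠] (0 : ℝ), |s * x| ≤ 1 := h0.eventually (eventually_le_nhds one_pos)
  have hne : ∀ᶠ s : ℝ in 𝓝[≠] (0 : ℝ), s ≠ 0 := self_mem_nhdsWithin
  have key : ∀ s : ℝ, s ≠ 0 → |s * x| ≤ 1 →
      |(1 - Real.cos (s * x)) / s ^ 2 - x ^ 2 / 2| ≤ 5 / 96 * x ^ 4 * s ^ 2 := by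
    intro s hs hsx
    have hb := Real.cos_bound hsx
    have hs2 : (0 : ℝ) < s ^ 2 := by positivity
    have heq : (1 - Real.cos (s * x)) / s ^ 2 - x ^ 2 / 2 =
        -(Real.cos (s * x) - (1 - (s * x) ^ 2 / 2)) / s ^ 2 := by
      field_simp
      ring
    rw [heq, abs_div, abs_neg, abs_of_pos hs2, div_le_iff₀ hs2]
    calc |Real.cos (s * x) - (1 - (s * x) ^ 2 / 2)| ≤ |s * x| ^ 4 * (5 / 96) := hb
      _ = 5 / 96 * x ^ 4 * s ^ 2 * s ^ 2 := by
          rw [(by decide : Even 4).pow_abs]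
          ring
  have hbound : Tendsto (fun s : ℝ => 5 / 96 * x ^ 4 * s ^ 2) (𝓝[≠] (0 : ℝ)) (𝓝 0) := by
    have : Tendsto (fun s : ℝ => 5 / 96 * x ^ 4 * s ^ 2) (𝓝 (0 : ℝ))
        (𝓝 (5 / 96 * x ^ 4 * (0 : ℝ) ^ 2)) :=
      (continuous_const.mul (continuous_pow 2)).tendsto 0
    rw [zero_pow two_ne_zero, mul_zero] at this
    exact this.mono_left nhdsWithin_le_nhds
  rw [tendsto_iff_norm_sub_tendsto_zero]
  refine squeeze_zero' (Eventually.of_forall fun s => norm_nonneg _) ?_ hbound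
  filter_upwards [hev, hne] with s hsx hs
  rw [Real.norm_eq_abs]
  exact key s hs hsx

variable {Ω : Type*} [MeasurableSpace Ω] {μ : Measure Ω}

/-- Integrability of `ω ↦ cos(s X ω)` on a finite measure space, for measurable `X`. -/
theorem integrable_cos_mul [IsFiniteMeasure μ] {X : Ω → ℝ} (hXm : Measurable X) (s : ℝ) :
    Integrable (fun ω => Real.cos (s * X ω)) μ := by
  refine (integrable_const (1 : ℝ)).mono' ?_ (Eventually.of_forall fun ω => ?_)
  · exact (by fun_prop : Measurable fun ω => Real.cos (s * X ω)).aestronglyMeasurable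
  · rw [Real.norm_eq_abs]
    exact Real.abs_cos_le_one _

/-- **Second moment from the characteristic function.** For a probability measure `μ` and a
measurable `X : Ω → ℝ` with `X²` integrable,
`(1 - ∫ cos(s X) dμ) / s² → (∫ X² dμ) / 2` as `s → 0`, `s ≠ 0` (dominated convergence along
`𝓝[≠] 0` with bound `X²/2` and the pointwise limit `CosMoment.tendsto_one_sub_cos_div_sq`). -/
theorem tendsto_one_sub_integral_cos_div_sq [IsProbabilityMeasure μ] {X : Ω → ℝ}
    (hXm : Measurable X) (hX2 : Integrable (fun ω => X ω ^ 2) μ) :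
    Tendsto (fun s : ℝ => (1 - ∫ ω, Real.cos (s * X ω) ∂μ) / s ^ 2) (𝓝[≠] 0)
      (𝓝 ((∫ ω, X ω ^ 2 ∂μ) / 2)) := by
  have h1 : (fun s : ℝ => (1 - ∫ ω, Real.cos (s * X ω) ∂μ) / s ^ 2) =
      fun s : ℝ => ∫ ω, (1 - Real.cos (s * X ω)) / s ^ 2 ∂μ := by
    funext s
    rw [integral_div, integral_sub (integrable_const 1) (integrable_cos_mul hXm s)]
    simp
  have h2 : (∫ ω, X ω ^ 2 ∂μ) / 2 = ∫ ω, X ω ^ 2 / 2 ∂μ := (integral_div 2 _).symm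
  rw [h1, h2]
  refine tendsto_integral_filter_of_dominated_convergence (fun ω => X ω ^ 2 / 2) ?_ ?_
    (hX2.div_const 2) ?_
  · exact Eventually.of_forall fun s =>
      (by fun_prop : Measurable fun ω => (1 - Real.cos (s * X ω)) / s ^ 2).aestronglyMeasurable
  · exact Eventually.of_forall fun s => Eventually.of_forall fun ω =>
      norm_one_sub_cos_div_sq_le s (X ω)
  · exact Eventually.of_forall fun ω => tendsto_one_sub_cos_div_sq (X ω)

end CosMoment

/-- STUB F6 — **cos moment**: for a probability measure `τ` on `ℝ^D`-valued `2`-cochains of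
`ℤ⁴` with square-integrable coordinates, the second moment of the finite pairing
`X = ⟨Y, h⟩_S = ∑_{p ∈ S} ∑_a h p a * Y p a` is the second-order coefficient of its
characteristic function: `(1 - E[cos(s X)]) / s² → E[X²] / 2` as `s → 0`, `s ≠ 0`
(`CosMoment.tendsto_one_sub_integral_cos_div_sq`; `X ∈ L²` as a finite sum of `L²`
coordinates, `memLp_finsetSum`, `MemLp.const_mul`, `memLp_two_iff_integrable_sq`). -/
theorem stub_cosMoment :
    ∀ (D : ℕ) (τ : MeasureTheory.Measure
        (Literature.MathematicalPhysics.QuantumLattice.ZdPlaquette 4 → Fin D → ℝ)),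
      MeasureTheory.IsProbabilityMeasure τ →
      (∀ (p : Literature.MathematicalPhysics.QuantumLattice.ZdPlaquette 4) (a : Fin D),
        MeasureTheory.Integrable (fun Y => (Y p a) ^ 2) τ) →
      ∀ (S : Finset (Literature.MathematicalPhysics.QuantumLattice.ZdPlaquette 4))
        (h : Literature.MathematicalPhysics.QuantumLattice.ZdPlaquette 4 → Fin D → ℝ),
        Filter.Tendsto (fun s : ℝ =>
            (1 - ∫ Y, Real.cos (s * ∑ p ∈ S, ∑ a : Fin D, h p a * Y p a) ∂τ) / s ^ 2)
          (nhdsWithin 0 {(0 : ℝ)}ᶜ)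
          (nhds ((∫ Y, (∑ p ∈ S, ∑ a : Fin D, h p a * Y p a) ^ 2 ∂τ) / 2)) := by
  intro D τ hτ hint S h
  have hcoord : ∀ (p : ZdPlaquette 4) (a : Fin D),
      Measurable fun Y : ZdPlaquette 4 → Fin D → ℝ => Y p a := fun p a =>
    (measurable_pi_apply a).comp (measurable_pi_apply p)
  have hXm : Measurable fun Y : ZdPlaquette 4 → Fin D → ℝ =>
      ∑ p ∈ S, ∑ a : Fin D, h p a * Y p a :=
    Finset.measurable_sum S fun p _ => Finset.measurable_sum Finset.univ fun a _ =>
      (hcoord p a).const_mul (h p a)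
  have hX2 : MemLp (fun Y : ZdPlaquette 4 → Fin D → ℝ =>
      ∑ p ∈ S, ∑ a : Fin D, h p a * Y p a) 2 τ :=
    memLp_finsetSum S fun p _ => memLp_finsetSum Finset.univ fun a _ =>
      ((memLp_two_iff_integrable_sq (hcoord p a).aestronglyMeasurable).2 (hint p a)).const_mul
        (h p a)
  exact CosMoment.tendsto_one_sub_integral_cos_div_sq hXm hX2.integrable_sq

end Summit.QuantumFields.YangMills.Theorems.EquipartitionPinsProbe

end
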